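import Literature.RepresentationTheory.GeneralLinear.WreathHighestWeight
import HarnessLib

/-!
# Signed orbit sums under the wreath product `S_n ≀ S_m`: the vectors `v_P`, `w_P` of
# Fischer–Ikenmeyer's proof of Thm. 4, and a highest-weight criterion

N. Fischer, C. Ikenmeyer, *The computational complexity of plethysm coefficients*, Comput.
Complexity 29 (2020) 8, §5, proof of Thm. 4: to a point set `P` one attaches
`v_P := ⋀_{(x,y,z) ∈ P} X_x X_y X_z ∈ Λⁿ Sym³ V` and `w_P := ⋀ X_x ∧ X_y ∧ X_z ∈ Λⁿ Λ³ V`; these are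
weight vectors, the `v_P` (resp. `w_P`) of the point sets with a given sum-marginal form a basis of
the weight space, and for a PYRAMID `P` the vector is a highest-weight vector ("`v_P` is
annihilated by all raising operators `E_{i,j}` … pyramids are point sets not containing 'holes',
thus `P` is transformed by mapping two points onto each other. Here comes the alternating property
of the wedge product into play by annihilating the summand").

In the word model of `WreathHighestWeight.lean` (functions on words `w : Fin (n·m) → Fin N`,
`H = S_n ≀ S_m = blockPerms n m`, a `±1`-valued character `χ` of `H`), the wedge/symmetric
monomial attached to a word `w` is the **signed orbit sum**

  `twistedOrbitSum χ (δ_w) = ∑_{τ ∈ H} χ(τ) δ_{w ∘ τ}`     (`twistedOrbitSum_single`),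

the image of the basis vector `δ_w` under `A_χ = ∑_τ χ(τ) · (τ⁻¹ acting on positions)`. This file
proves, for general `m` and `χ` (any field of characteristic zero):

* `A_χ` commutes with `GL_N` (`twistedOrbitSum_wordRep`) and lands in the `χ`-isotypic vectors
  (`wordPerm_twistedOrbitSum`);
* **the alternating property**: `A_χ δ_w = 0` as soon as some `τ₀ ∈ H` fixes `w` with
  `χ(τ₀) = -1` (`twistedOrbitSum_single_eq_zero`), and `(A_χ δ_w)(w) ≠ 0` if `χ = 1` on the
  stabiliser of `w` (`twistedOrbitSum_single_apply_self_ne_zero`);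
* **a highest-weight criterion** (`twistedOrbitSum_single_mem_wreathHW`): if every word `u ≤ w`
  (letterwise) with `A_χ δ_u ≠ 0` equals `w`, then `A_χ δ_w` is a highest-weight vector of weight
  `content(w)` — the group form of FI's raising-operator computation: an upper triangular `b` maps
  `δ_w` to a combination of `δ_u`, `u ≤ w` (`wordRep_single_eq_sum`), `A_χ` kills the `u ≠ w`, and
  the coefficient of `δ_w` is `∏_p b_{w_p w_p} = b^{content(w)}`.

The combinatorial verification of the criterion for the words of cone pyramids (`m = 3`) and the
converse support statements are in `PlethysmTomographyBounds.lean`.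

## References

* [FischerIkenmeyer2020] §5, Thm. 4 and its proof.
* [FultonHarrisGTM129] §15.3 (highest-weight vectors as `B`-semi-invariants), Lemma 6.22.
-/

noncomputable section

open scoped BigOperators

namespace Literature.RepresentationTheory.GeneralLinear

open Literature.NumberTheory.DiophantineGeometry Literature.Computability.AlgebraicComplexity

section OrbitSum

variable (k : Type*) [Field k] {N n m : ℕ}

/-- **The signed orbit-sum operator `A_χ = ∑_{τ ∈ S_n ≀ S_m} χ(τ) · wordPerm τ⁻¹`** on the word model
of `(k^N)^{⊗nm}` (so that `A_χ δ_w = ∑_τ χ(τ) δ_{w ∘ τ}`): the unnormalised projector onto the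
`χ`-isotypic vectors; `A_1` is BIP's wreath symmetriser `Σ_{d,n}` (4.1), and `A_χ δ_w` for the
`Λ`-type characters are FI's wedge monomials `v_P`, `w_P`.
[cite: FischerIkenmeyer2020, §5 (proof of Thm. 4)] -/
def twistedOrbitSum (χ : ↥(blockPerms n m) →* ℤˣ) :
    (Word N (n * m) → k) →ₗ[k] (Word N (n * m) → k) :=
  ∑ τ : ↥(blockPerms n m),
    (((χ τ : ℤˣ) : ℤ) : k) • wordPerm k ((τ⁻¹ : ↥(blockPerms n m)) : Equiv.Perm (Fin (n * m)))

variable {k}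

/-- `A_χ c = ∑_τ χ(τ) • wordPerm τ⁻¹ c` (unfolding lemma). [folklore] -/
theorem twistedOrbitSum_apply (χ : ↥(blockPerms n m) →* ℤˣ) (c : Word N (n * m) → k) :
    twistedOrbitSum k χ c = ∑ τ : ↥(blockPerms n m),
      (((χ τ : ℤˣ) : ℤ) : k) • wordPerm k ((τ⁻¹ : ↥(blockPerms n m)) : Equiv.Perm (Fin (n * m))) c := by
  simp [twistedOrbitSum, LinearMap.sum_apply, LinearMap.smul_apply]

/-- **`A_χ δ_w = ∑_τ χ(τ) δ_{w ∘ τ}`**: the signed orbit sum of a word.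
[cite: FischerIkenmeyer2020, §5 (proof of Thm. 4)] -/
theorem twistedOrbitSum_single (χ : ↥(blockPerms n m) →* ℤˣ) (w : Word N (n * m)) :
    twistedOrbitSum k χ (Pi.single w 1) = ∑ τ : ↥(blockPerms n m),
      (((χ τ : ℤˣ) : ℤ) : k) • Pi.single (w ∘ ⇑(τ : Equiv.Perm (Fin (n * m)))) (1 : k) := by
  rw [twistedOrbitSum_apply]
  refine Finset.sum_congr rfl fun τ _ => ?_
  rw [wordPerm_single, Subgroup.coe_inv, inv_inv]

/-- Value of the signed orbit sum: `(A_χ δ_w)(u) = ∑_{τ : w ∘ τ = u} χ(τ)`. [folklore] -/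
theorem twistedOrbitSum_single_apply (χ : ↥(blockPerms n m) →* ℤˣ) (w u : Word N (n * m)) :
    twistedOrbitSum k χ (Pi.single w 1) u = ∑ τ : ↥(blockPerms n m),
      if w ∘ ⇑(τ : Equiv.Perm (Fin (n * m))) = u then (((χ τ : ℤˣ) : ℤ) : k) else 0 := by
  rw [twistedOrbitSum_single, Finset.sum_apply]
  refine Finset.sum_congr rfl fun τ _ => ?_
  rw [Pi.smul_apply, smul_eq_mul]
  by_cases h : w ∘ ⇑(τ : Equiv.Perm (Fin (n * m))) = u
  · rw [if_pos h, h, Pi.single_eq_same, mul_one]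
  · rw [if_neg h, Pi.single_eq_of_ne (Ne.symm h), mul_zero]

/-- **`A_χ` commutes with `GL_N`** (position permutations commute with the diagonal action,
Fulton–Harris Lemma 6.22). [folklore] -/
theorem twistedOrbitSum_wordRep (χ : ↥(blockPerms n m) →* ℤˣ) (g : GL (Fin N) k)
    (c : Word N (n * m) → k) :
    twistedOrbitSum k χ (wordRep k N (n * m) g c) = wordRep k N (n * m) g (twistedOrbitSum k χ c) := by
  rw [twistedOrbitSum_apply, twistedOrbitSum_apply, map_sum]
  refine Finset.sum_congr rfl fun τ _ => ?_
  rw [map_smul, wordPerm_wordRep]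

/-- **`A_χ` lands in the `χ`-isotypic vectors**: `wordPerm σ (A_χ c) = χ(σ) • A_χ c` for `σ ∈ H`
(reindex the sum by `τ ↦ τ σ`). [folklore] -/
theorem wordPerm_twistedOrbitSum (χ : ↥(blockPerms n m) →* ℤˣ) (σ : ↥(blockPerms n m))
    (c : Word N (n * m) → k) :
    wordPerm k (σ : Equiv.Perm (Fin (n * m))) (twistedOrbitSum k χ c) =
      (((χ σ : ℤˣ) : ℤ) : k) • twistedOrbitSum k χ c := by
  rw [twistedOrbitSum_apply, map_sum, Finset.smul_sum]
  rw [← Equiv.sum_comp (Equiv.mulRight σ)]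
  refine Finset.sum_congr rfl fun τ _ => ?_
  simp only [Equiv.coe_mulRight, map_smul, map_mul, Units.val_mul, Int.cast_mul, mul_inv_rev,
    Subgroup.coe_mul, Subgroup.coe_inv]
  rw [← LinearMap.comp_apply (f := wordPerm k (σ : Equiv.Perm (Fin (n * m)))), ← wordPerm_mul,
    ← mul_assoc, mul_inv_cancel, one_mul, smul_smul,
    mul_comm (((χ σ : ℤˣ) : ℤ) : k) (((χ τ : ℤˣ) : ℤ) : k)]

/-- **The alternating property**: if some `τ₀ ∈ H` fixes the word `w` and `χ(τ₀) = -1`, then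
`A_χ δ_w = 0` (reindex by `τ ↦ τ₀ τ`: the sum equals its negative). This is "the alternating
property of the wedge product … annihilating the summand" of FI's proof (a monomial with a repeated
factor in a wedge power vanishes). [cite: FischerIkenmeyer2020, §5 (proof of Thm. 4)] -/
theorem twistedOrbitSum_single_eq_zero [CharZero k] (χ : ↥(blockPerms n m) →* ℤˣ)
    {w : Word N (n * m)} {τ₀ : ↥(blockPerms n m)} (hfix : w ∘ ⇑(τ₀ : Equiv.Perm (Fin (n * m))) = w)
    (hodd : χ τ₀ = -1) : twistedOrbitSum k χ (Pi.single w 1) = 0 := by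
  suffices h : twistedOrbitSum k χ (Pi.single w 1) = -twistedOrbitSum k χ (Pi.single w 1) by
    have h2 : (2 : k) • twistedOrbitSum k χ (Pi.single w 1) = 0 := by
      rw [two_smul]; nth_rw 2 [h]; exact add_neg_cancel _
    exact (smul_eq_zero.mp h2).resolve_left two_ne_zero
  rw [twistedOrbitSum_single]
  conv_lhs => rw [← Equiv.sum_comp (Equiv.mulLeft τ₀)]
  rw [← Finset.sum_neg_distrib]
  refine Finset.sum_congr rfl fun τ _ => ?_
  rw [Equiv.coe_mulLeft, map_mul, hodd, Units.val_mul, Units.val_neg, Units.val_one, Int.cast_mul,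
    Int.cast_neg, Int.cast_one, neg_one_mul, neg_smul, Subgroup.coe_mul, Equiv.Perm.coe_mul,
    ← Function.comp_assoc, hfix]

/-- Pointwise form of the alternating property for an isotypic vector: if `x` is `χ`-isotypic and
`τ₀ ∈ H` fixes `u` with `χ(τ₀) = -1` then `x u = 0`. [cite: FischerIkenmeyer2020, §5 (proof of Thm. 4)] -/
theorem apply_eq_zero_of_odd_stabilizer [CharZero k] {χ : ↥(blockPerms n m) →* ℤˣ}
    {μ : Weight (Fin N)} {x : Word N (n * m) → k} (hx : x ∈ wreathHW k N χ μ) {u : Word N (n * m)}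
    {τ₀ : ↥(blockPerms n m)} (hfix : u ∘ ⇑(τ₀ : Equiv.Perm (Fin (n * m))) = u) (hodd : χ τ₀ = -1) :
    x u = 0 := by
  have h := apply_comp_of_mem_wreathHW hx τ₀ u
  rw [hfix, hodd, Units.val_neg, Units.val_one, Int.cast_neg, Int.cast_one, neg_one_mul] at h
  have h2 : (2 : k) * x u = 0 := by rw [two_mul]; nth_rw 2 [h]; exact add_neg_cancel _
  exact (mul_eq_zero.mp h2).resolve_left two_ne_zero

/-- **Nonvanishing**: if `χ = 1` on the stabiliser of `w` in `H`, then `(A_χ δ_w)(w) = |Stab_H(w)| ≠ 0`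
(characteristic zero). [cite: FischerIkenmeyer2020, §5 (proof of Thm. 4)] -/
theorem twistedOrbitSum_single_apply_self_ne_zero [CharZero k] (χ : ↥(blockPerms n m) →* ℤˣ)
    {w : Word N (n * m)}
    (hstab : ∀ τ : ↥(blockPerms n m), w ∘ ⇑(τ : Equiv.Perm (Fin (n * m))) = w → χ τ = 1) :
    twistedOrbitSum k χ (Pi.single w 1) w ≠ 0 := by
  classical
  rw [twistedOrbitSum_single_apply]
  have h : (∑ τ : ↥(blockPerms n m),
      (if w ∘ ⇑(τ : Equiv.Perm (Fin (n * m))) = w then (((χ τ : ℤˣ) : ℤ) : k) else 0)) =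
      ((Finset.univ.filter fun τ : ↥(blockPerms n m) =>
        w ∘ ⇑(τ : Equiv.Perm (Fin (n * m))) = w).card : k) := by
    rw [Finset.card_eq_sum_ones, Nat.cast_sum, Finset.sum_filter]
    refine Finset.sum_congr rfl fun τ _ => ?_
    by_cases hτ : w ∘ ⇑(τ : Equiv.Perm (Fin (n * m))) = w
    · rw [if_pos hτ, if_pos hτ, hstab τ hτ, Units.val_one, Int.cast_one, Nat.cast_one]
    · rw [if_neg hτ, if_neg hτ]
  rw [h, Nat.cast_ne_zero, ← Nat.pos_iff_ne_zero, Finset.card_pos]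
  exact ⟨1, Finset.mem_filter.mpr ⟨Finset.mem_univ _, by simp⟩⟩

/-- The signed orbit sum does not vanish at `w` itself, hence is nonzero, if `χ = 1` on the
stabiliser. [folklore] -/
theorem twistedOrbitSum_single_ne_zero [CharZero k] (χ : ↥(blockPerms n m) →* ℤˣ)
    {w : Word N (n * m)}
    (hstab : ∀ τ : ↥(blockPerms n m), w ∘ ⇑(τ : Equiv.Perm (Fin (n * m))) = w → χ τ = 1) :
    twistedOrbitSum k χ (Pi.single w 1) ≠ 0 := fun h =>
  twistedOrbitSum_single_apply_self_ne_zero χ hstab (by rw [h, Pi.zero_apply])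

/-! ### The action of an upper triangular matrix on a basis vector -/

/-- **`g · δ_w = ∑_u (∏_p g_{u_p w_p}) δ_u`**: the `w`-th column of the tree's Kronecker power
`tensorPowerMatrix` (`TensorWordModel.lean`). Fulton, *Young Tableaux*, §8.1. [folklore] -/
theorem wordRep_single_eq_sum (g : GL (Fin N) k) (w : Word N (n * m)) :
    wordRep k N (n * m) g (Pi.single w 1) =
      ∑ u, tensorPowerMatrix k N (n * m) (g : Matrix (Fin N) (Fin N) k) u w • Pi.single u (1 : k) := by
  funext u'
  rw [wordRep_single, Finset.sum_apply, Finset.sum_eq_single u']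
  · rw [Pi.smul_apply, Pi.single_eq_same, smul_eq_mul, mul_one, tensorPowerMatrix_apply]
  · intro u _ hu
    rw [Pi.smul_apply, Pi.single_eq_of_ne (Ne.symm hu), smul_zero]
  · intro h; exact absurd (Finset.mem_univ u') h

/-- For upper triangular `b`, the entry `(u, w)` of the Kronecker power — the coefficient of `δ_u` in
`b · δ_w` — vanishes unless `u ≤ w` letterwise. [cite: FultonHarrisGTM129, §15.3] -/
theorem tensorPowerMatrix_eq_zero_of_not_le {b : GL (Fin N) k} (hb : IsUpperTriangular b)
    {u w : Word N (n * m)} (h : ¬ ∀ p, u p ≤ w p) :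
    tensorPowerMatrix k N (n * m) (b : Matrix (Fin N) (Fin N) k) u w = 0 := by
  push Not at h
  obtain ⟨p, hp⟩ := h
  rw [tensorPowerMatrix_apply]
  exact Finset.prod_eq_zero (Finset.mem_univ p) (hb.apply_eq_zero hp)

/-- The diagonal entry of the Kronecker power is the weight character of the content:
`∏_p b_{w_p w_p} = b^{content(w)}`. [cite: FultonHarrisGTM129, §15.3] -/
theorem tensorPowerMatrix_self (b : GL (Fin N) k) (w : Word N (n * m)) :
    tensorPowerMatrix k N (n * m) (b : Matrix (Fin N) (Fin N) k) w w =
      weightChar (fun i => (wordContent w i : ℤ)) b := by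
  rw [tensorPowerMatrix_apply, weightChar,
    prod_eq_prod_pow_wordContent (fun i => (b : Matrix (Fin N) (Fin N) k) i i) w]
  refine Finset.prod_congr rfl fun i _ => ?_
  rw [zpow_natCast]

/-- **Highest-weight criterion for signed orbit sums.** If every word `u ≤ w` (letterwise) with
`A_χ δ_u ≠ 0` equals `w`, then `A_χ δ_w` is a highest-weight vector of weight `content(w)`: an
upper triangular `b` gives `b · A_χ δ_w = A_χ (b · δ_w) = ∑_{u ≤ w} (∏ b_{u_p w_p}) A_χ δ_u =
(∏ b_{w_p w_p}) A_χ δ_w`. This is the group form of FI's computation "`E_{i,j} v_P = 0` for all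
raising operators" (each surviving summand would come from a smaller word, i.e. a point moved
towards the origin, which the pyramid property excludes). [cite: FischerIkenmeyer2020, §5 (proof of Thm. 4)] -/
theorem twistedOrbitSum_single_mem_highestWeightSpace (χ : ↥(blockPerms n m) →* ℤˣ)
    (w : Word N (n * m))
    (hgood : ∀ u : Word N (n * m), (∀ p, u p ≤ w p) →
      twistedOrbitSum k χ (Pi.single u 1) ≠ 0 → u = w) :
    twistedOrbitSum k χ (Pi.single w 1) ∈
      highestWeightSpace (wordRep k N (n * m)) (fun i => (wordContent w i : ℤ)) := by
  intro b hb
  rw [← twistedOrbitSum_wordRep, wordRep_single_eq_sum, map_sum, Finset.sum_eq_single w]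
  · rw [map_smul, tensorPowerMatrix_self]
  · intro u _ hu
    rw [map_smul]
    by_cases hle : ∀ p, u p ≤ w p
    · have : twistedOrbitSum k χ (Pi.single u 1) = 0 := by
        by_contra hne
        exact hu (hgood u hle hne)
      rw [this, smul_zero]
    · rw [tensorPowerMatrix_eq_zero_of_not_le hb hle, zero_smul]
  · intro h; exact absurd (Finset.mem_univ w) h

/-- **Highest-weight criterion, `wreathHW` form**: under the hypothesis of
`twistedOrbitSum_single_mem_highestWeightSpace`, `A_χ δ_w ∈ wreathHW k N χ (content w)`.
[cite: FischerIkenmeyer2020, §5 (proof of Thm. 4)] -/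
theorem twistedOrbitSum_single_mem_wreathHW (χ : ↥(blockPerms n m) →* ℤˣ) (w : Word N (n * m))
    (hgood : ∀ u : Word N (n * m), (∀ p, u p ≤ w p) →
      twistedOrbitSum k χ (Pi.single u 1) ≠ 0 → u = w) :
    twistedOrbitSum k χ (Pi.single w 1) ∈ wreathHW k N χ (fun i => (wordContent w i : ℤ)) :=
  ⟨twistedOrbitSum_single_mem_highestWeightSpace χ w hgood, fun σ => wordPerm_twistedOrbitSum χ σ _⟩

/-! ### Support of isotypic highest-weight vectors -/

/-- **Support**: a nonzero value `x u ≠ 0` of a vector of `wreathHW χ μ` forces `content(u) = μ`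
(weight vectors of the word model are supported on words of the right content, characteristic zero)
and the absence of `τ₀ ∈ Stab_H(u)` with `χ(τ₀) = -1`. [cite: FischerIkenmeyer2020, §5 (proof of Thm. 4)] -/
theorem content_eq_and_no_odd_of_apply_ne_zero [CharZero k] {χ : ↥(blockPerms n m) →* ℤˣ}
    {μ : Weight (Fin N)} {x : Word N (n * m) → k} (hx : x ∈ wreathHW k N χ μ) {u : Word N (n * m)}
    (hu : x u ≠ 0) :
    (∀ i, (wordContent u i : ℤ) = μ i) ∧
      ∀ τ₀ : ↥(blockPerms n m), u ∘ ⇑(τ₀ : Equiv.Perm (Fin (n * m))) = u → χ τ₀ ≠ -1 := by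
  refine ⟨fun i => ?_, fun τ₀ hfix hodd => hu (apply_eq_zero_of_odd_stabilizer hx hfix hodd)⟩
  by_contra hi
  exact hu (apply_eq_zero_of_mem_highestWeightSpace k hx.1 hi)

end OrbitSum

end Literature.RepresentationTheory.GeneralLinear
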